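import Summits.QuantumFields.YangMills.Theses.UnitScaleTilt
import Summits.QuantumFields.YangMills.Theorems.UnitScaleTiltAvgActionDefectFirstOrder

/-!
# Route `UnitScaleTilt` — crux K2 `HistoryTail` (stmt-QuantumFields-18916): PROPAGATION OF A REGULARITY PROFILE UP THE AVERAGING TOWER —
# `|U(∂q) − 1| < a_0` everywhere ⇒ `|Ū^{s}(∂q) − 1| < a_s` for every profile with `L²a_s + 435t_s² < a_{s+1}` (support file; the «(68) + first-order
# averaging bound» clause of the consumer contract, global form)

Fleet lead `ym-ust-18916-p1` (gen 0); consumer contract `CONTRACT-18916-AlphaDataT3.md` (evidence #18 on the item), clause C2: the regularity profile of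
the intermediate averaged fields `Ū^{s}` of a (68)-regular fine field is (68) transported by the FIRST-ORDER averaging bound — each (0.4) step multiplies
the plaquette radius by the area factor `L²` up to the quadratic remainder `435t²` (`AvgActionDefect.dist1_plaqHol_avgFun_le_mean_add`, p437295:
`|Ū(∂p′) − 1| ≤ L^{−d}Σ_rΣ_{t,s}|U(∂q_{r,s,t}) − 1| + 435t²`, and the mean of `L^d·L²` terms each `< a` is `≤ L²a`).  THIS FILE proves the GLOBAL form:
* `dist1_plaqHol_avgFun_le_sq_mul` — `PlaqSmall a U`, `t = ((d+2)L)²a/4 ≤ 1/10`, `t < δ_N` ⇒ `|Ū(∂p′) − 1| ≤ L²·a + 435t²` for every coarse plaquette;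
* `plaqSmall_iter_of_profile` — for any profile `a : ℕ → ℝ` with `0 ≤ a_s`, `t_s ≤ 1/10`, `t_s < δ_N` and `L²a_s + 435t_s² < a_{s+1}` for `s < j`:
  `PlaqSmall (a 0) U ⇒ PlaqSmall (a s) (Ū^{s})` for all `s ≤ j` (standing range) — so print's (68) at the finest level with `a_0 ≍ θ·L^{−2j}` yields
  `a_s ≍ θ·L^{−2(j−s)}` at every level, the profile `HistoryTailRemainder.remainder_le` (p445870) is stated for.
The LOCAL form (regularity on the region tower under one plaquette only) follows the same recursion with `HistoryTailFirstOrderLocal` (p446258) and shrinking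
boxes; not in this file.

WHAT THIS IS NOT: (68) itself (an input of mechanism A, S2's minimiser data); nothing of (41)/(47); nothing uses (α).
-/

noncomputable section

open scoped BigOperators Matrix.Norms.L2Operator

namespace Summit.QuantumFields.YangMills.Theorems.HistoryTailProfile

open Literature.MathematicalPhysics.QuantumFieldTheory.Balaban1983to89
open T4Continuum BlockAveraging AveragingRT ExpMeanLog BlockAveragingPlaquetteBound
open B10Eq47AxialChi (shiftN)
open Summit.QuantumFields.YangMills.Theorems.AvgActionDefect (dist1_plaqHol_avgFun_le_mean_add)

variable {n : Type*} [Fintype n] [DecidableEq n] [Nonempty n] {P : Params} {j : ℕ}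

/-- **ONE STEP: THE PLAQUETTE RADIUS GROWS BY THE AREA FACTOR `L²` TO FIRST ORDER**: under `PlaqSmall a U` (`a ≥ 0`), `t = ((d+2)L)²a/4 ≤ 1/10`,
`t < δ_N`, every coarse plaquette of the (0.4)+`exp[mean log]` average satisfies `|Ū(∂p′) − 1| ≤ L²·a + 435t²` (the mean over the `L^d·L²` square
plaquettes, each `< a`). [cite: Balaban1987RG1, (0.4) p.253; Balaban1985UV3, (68) p.273] -/
theorem dist1_plaqHol_avgFun_le_sq_mul (hj : j + 1 ≤ P.m + P.K) {a : ℝ} (ha : 0 ≤ a)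
    {U : GaugeField P j (Matrix.specialUnitaryGroup n ℂ)} (hU : PlaqSmall a U)
    (ht : ((((P.d + 2) * P.L : ℕ) : ℝ) ^ 2 / 4) * a ≤ 1 / 10) (hδ : ((((P.d + 2) * P.L : ℕ) : ℝ) ^ 2 / 4) * a < deltaSU n)
    (p : Plaq P (j + 1)) :
    dist1 (GaugeField.plaqHol (avgFun (expMeanLogSU (n := n)) U) p) ≤
      (P.L : ℝ) ^ 2 * a + 435 * (((((P.d + 2) * P.L : ℕ) : ℝ) ^ 2 / 4) * a) ^ 2 := by
  have h := dist1_plaqHol_avgFun_le_mean_add (n := n) hj ha hU ht hδ p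
  have hL : (0 : ℝ) < P.L := Nat.cast_pos.mpr P.L_pos
  have hLd : (0 : ℝ) < (P.L : ℝ) ^ P.d := by positivity
  -- each of the `L^d · L²` square plaquettes is `< a`
  have hsum : ∑ r : Fin P.d → Fin P.L, ∑ t ∈ Finset.range P.L, ∑ s ∈ Finset.range P.L,
      dist1 (GaugeField.plaqHol U ⟨shiftN (shiftN (Site.blockSite p.src r) p.ν t) p.μ s, p.μ, p.ν, p.hμν⟩) ≤
      (P.L : ℝ) ^ P.d * ((P.L : ℝ) ^ 2 * a) := by
    calc ∑ r : Fin P.d → Fin P.L, ∑ t ∈ Finset.range P.L, ∑ s ∈ Finset.range P.L,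
          dist1 (GaugeField.plaqHol U ⟨shiftN (shiftN (Site.blockSite p.src r) p.ν t) p.μ s, p.μ, p.ν, p.hμν⟩)
        ≤ ∑ _r : Fin P.d → Fin P.L, ∑ _t ∈ Finset.range P.L, ∑ _s ∈ Finset.range P.L, a :=
          Finset.sum_le_sum fun r _ => Finset.sum_le_sum fun t _ => Finset.sum_le_sum fun s _ => (hU _).le
      _ = (P.L : ℝ) ^ P.d * ((P.L : ℝ) ^ 2 * a) := by
          rw [Finset.sum_const, Finset.card_univ, Fintype.card_fun, Fintype.card_fin, Fintype.card_fin]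
          simp only [Finset.sum_const, Finset.card_range, nsmul_eq_mul]
          push_cast
          ring
  have hmean : ((P.L : ℝ) ^ P.d)⁻¹ * ∑ r : Fin P.d → Fin P.L, ∑ t ∈ Finset.range P.L, ∑ s ∈ Finset.range P.L,
      dist1 (GaugeField.plaqHol U ⟨shiftN (shiftN (Site.blockSite p.src r) p.ν t) p.μ s, p.μ, p.ν, p.hμν⟩) ≤ (P.L : ℝ) ^ 2 * a := by
    calc ((P.L : ℝ) ^ P.d)⁻¹ * ∑ r : Fin P.d → Fin P.L, ∑ t ∈ Finset.range P.L, ∑ s ∈ Finset.range P.L,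
          dist1 (GaugeField.plaqHol U ⟨shiftN (shiftN (Site.blockSite p.src r) p.ν t) p.μ s, p.μ, p.ν, p.hμν⟩)
        ≤ ((P.L : ℝ) ^ P.d)⁻¹ * ((P.L : ℝ) ^ P.d * ((P.L : ℝ) ^ 2 * a)) :=
          mul_le_mul_of_nonneg_left hsum (inv_nonneg.mpr hLd.le)
      _ = (P.L : ℝ) ^ 2 * a := by field_simp
  linarith [h, hmean]

/-- **PROPAGATION OF A PROFILE UP THE TOWER** (standing range `j ≤ m + K`; `SU(N)`): for a profile `a : ℕ → ℝ` with `0 ≤ a_s`,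
`t_s = ((d+2)L)²a_s/4 ≤ 1/10`, `t_s < δ_N` and `L²a_s + 435t_s² < a_{s+1}` for all `s < j`, `PlaqSmall (a 0) U` implies `PlaqSmall (a s) (Ū^{s})` for
every `s ≤ j`.  With `a_0 ≍ θ·L^{−2j}` ((68) at the finest level) the admissible profiles are `a_s ≍ θ·L^{−2(j−s)}` — the ones
`HistoryTailRemainder.remainder_le` is stated for. [cite: Balaban1985UV3, (68) p.273; Balaban1987RG1, (0.4) p.253] -/
theorem plaqSmall_iter_of_profile (U : GaugeField P 0 (Matrix.specialUnitaryGroup n ℂ)) (a : ℕ → ℝ) (j : ℕ) (hj : j ≤ P.m + P.K)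
    (ha : ∀ s, s < j → 0 ≤ a s)
    (ht : ∀ s, s < j → ((((P.d + 2) * P.L : ℕ) : ℝ) ^ 2 / 4) * a s ≤ 1 / 10)
    (hδ : ∀ s, s < j → ((((P.d + 2) * P.L : ℕ) : ℝ) ^ 2 / 4) * a s < deltaSU n)
    (hstep : ∀ s, s < j → (P.L : ℝ) ^ 2 * a s + 435 * (((((P.d + 2) * P.L : ℕ) : ℝ) ^ 2 / 4) * a s) ^ 2 < a (s + 1))
    (h0 : PlaqSmall (a 0) U) :
    ∀ s, s ≤ j → PlaqSmall (a s) (Averaging.iter (fun _ => BlockAveraging.blockAvg (expMeanLogSU (n := n))) s U)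
  | 0, _ => h0
  | s + 1, hs => by
    have hprev := plaqSmall_iter_of_profile U a j hj ha ht hδ hstep h0 s (by omega)
    have hs' : s < j := by omega
    have hsj : s + 1 ≤ P.m + P.K := by omega
    intro p
    have h := dist1_plaqHol_avgFun_le_sq_mul (n := n) hsj (ha s hs') hprev (ht s hs') (hδ s hs') p
    exact h.trans_lt (hstep s hs')

end Summit.QuantumFields.YangMills.Theorems.HistoryTailProfile

end
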